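import Literature.NumberTheory.EllipticCurves.AnomalousOfRationalTorsionProofs
import Literature.NumberTheory.EllipticCurves.DivisionPolynomialTorsion
import Literature.NumberTheory.EllipticCurves.IsogenyFrobeniusTraceProofs
import Literature.NumberTheory.EllipticCurves.TorsionCardinality
import HarnessLib

/-!
# Route G at `p = 3`: a rational `3`-torsion point replaces the kernel point count — `3 ∣ #Ẽ(𝔽_ℓ)`
# at every good `ℓ ≥ 5` (cell `bsd-eis`, seat `bsd-eis-ky` gen 4; THEOREMS ONLY, nothing booked)

HONEST FRAMING (FULL-BSD rank-≤1 programme D-0033, cell `bsd-eis`; row A10-split). The route-G displays at a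
split Eisenstein `3` (`X2/RouteGSplitDisplay*.lean`) evaluate Greenberg–Vatsal's local invariant `d_ℓ` (Prop.
(2.4); tree `X2/LocalDeltaCalculus.lean`) at a GOOD prime `ℓ ≠ 3` of one curve from `3 ∣ ℓ + 1 − a_ℓ = #Ẽ(𝔽_ℓ)`
(`dMultiplicity_of_hasGoodReductionAt_of_dvd`), so far decided by a kernel point count (feasible up to
`ℓ ≈ 600`). Most curves of the row carry a RATIONAL point of order `3` (75 of the 83 cells have
`3 ∣ #E(ℚ)_tors`; the λ-minimal relatives `219b1`, `564b1`, `402d1`, … likewise), and for those the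
divisibility is a THEOREM at every good `ℓ ≥ 5` with no counting: `E(ℚ)_tors ↪ Ẽ(𝔽_ℓ)`
(Silverman VII.3.1(b); tree `addOrderOf_dvd_reductionPointCount`). This file packages that step for the
display generator (`HOME/ky-gen/routeg_gen.py`): from an explicit rational point `(x₀, y₀)` with `Ψ₃(x₀) = 0`,
`Ψ₂Sq(x₀) ≠ 0` (order exactly `3`: `three_smul_some_eq_zero_iff`) to
`3 ∣ ℓ(v) + 1 − a_v` at the place `v` of any good `ℓ ≥ 3` other than… (the statement only needs `3 ≤ ℓ` and
`ℓ ∤ Δ_min`; at `ℓ = 3` itself it is the anomaly statement of `AnomalousOfRationalTorsionProofs`).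
References: [SilvermanAEC2009] VII.3 Prop. 3.1(b), III Ex. 3.7; [GreenbergVatsal2000] §2 Prop. (2.4).
-/

set_option autoImplicit false

noncomputable section

open scoped Classical

open WeierstrassCurve NumberField IsDedekindDomain Literature.NumberTheory.EllipticCurves

namespace Summit.BirchSwinnertonDyer.Rank1Residual.X2.RouteGThreeTorsion

/-- **A rational point `(x₀, y₀)` with `Ψ₃(x₀) = 0` and `Ψ₂Sq(x₀) ≠ 0` has order exactly `3`**
(`3·P = O` by the division polynomial, `P ≠ O`; Silverman III Ex. 3.7). [cite: SilvermanAEC2009, III Ex. 3.7] -/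
theorem addOrderOf_eq_three_of_eval_Ψ₃ (W : WeierstrassCurve ℚ) [W.IsElliptic] {x₀ y₀ : ℚ}
    (hP : W.toAffine.Nonsingular x₀ y₀) (hψ : W.Ψ₃.eval x₀ = 0) (hd : W.Ψ₂Sq.eval x₀ ≠ 0) :
    addOrderOf (Affine.Point.some x₀ y₀ hP) = 3 := by
  have hy : y₀ ≠ W.toAffine.negY x₀ y₀ := by
    intro e
    apply hd
    rw [← sub_negY_sq_eq_eval_Ψ₂Sq _ hP.left, sub_eq_zero.mpr e, zero_pow two_ne_zero]
  have h3 : (3 : ℤ) • (Affine.Point.some x₀ y₀ hP) = 0 :=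
    (WeierstrassCurve.three_smul_some_eq_zero_iff (V := W) hP hy).mpr (by rw [ψ_three, Polynomial.evalEval_C, hψ])
  have h3' : (3 : ℕ) • (Affine.Point.some x₀ y₀ hP) = 0 := by
    rw [← natCast_zsmul]; exact_mod_cast h3
  haveI : Fact (Nat.Prime 3) := ⟨Nat.prime_three⟩
  exact addOrderOf_eq_prime h3' (Affine.Point.some_ne_zero hP)

/-- **`3 ∣ ℓ + 1 − a_ℓ = #Ẽ(𝔽_ℓ)` at the place of a good prime `ℓ ≥ 3` for a curve with a rational
`3`-torsion point `(x₀, y₀)`** (`E(ℚ)_tors ↪ Ẽ(𝔽_ℓ)`, Silverman VII.3.1(b): tree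
`addOrderOf_dvd_reductionPointCount`) — the hypothesis of `dMultiplicity_of_hasGoodReductionAt_of_dvd` at
`p = 3`, obtained WITHOUT a point count. `hΔ : ℓ ∤ Δ_min` is good reduction at `ℓ`.
[cite: SilvermanAEC2009, VII.3 Prop. 3.1(b)] [cite: GreenbergVatsal2000, §2 Prop. (2.4)] -/
theorem three_dvd_natGenerator_add_one_sub_frobeniusTraceAt (W : WeierstrassCurve ℚ) [W.IsElliptic]
    [W.IsGloballyMinimal] {x₀ y₀ : ℚ} (hP : W.toAffine.Nonsingular x₀ y₀) (hψ : W.Ψ₃.eval x₀ = 0)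
    (hd : W.Ψ₂Sq.eval x₀ ≠ 0) (ℓ : ℕ) (hℓ : ℓ.Prime) (h3ℓ : 3 ≤ ℓ)
    (hΔ : ¬ (ℓ : ℤ) ∣ minimalDiscriminantInt W) :
    ((3 : ℕ) : ℤ) ∣ (Rat.HeightOneSpectrum.natGenerator
        ((Rat.HeightOneSpectrum.primesEquiv (R := 𝓞 ℚ)).symm ⟨ℓ, hℓ⟩) + 1 -
      W.frobeniusTraceAt ((Rat.HeightOneSpectrum.primesEquiv (R := 𝓞 ℚ)).symm ⟨ℓ, hℓ⟩) : ℤ) := by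
  haveI : Fact ℓ.Prime := ⟨hℓ⟩
  have hT := addOrderOf_eq_three_of_eval_Ψ₃ W hP hψ hd
  have hfin : IsOfFinAddOrder (Affine.Point.some x₀ y₀ hP) :=
    addOrderOf_pos_iff.mp (by rw [hT]; norm_num)
  have hdvd : 3 ∣ W.reductionPointCount ℓ := hT ▸ addOrderOf_dvd_reductionPointCount W ℓ h3ℓ hΔ hfin
  have hgen : Rat.HeightOneSpectrum.natGenerator
      ((Rat.HeightOneSpectrum.primesEquiv (R := 𝓞 ℚ)).symm ⟨ℓ, hℓ⟩) = ℓ :=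
    congrArg Subtype.val (Equiv.apply_symm_apply (Rat.HeightOneSpectrum.primesEquiv (R := 𝓞 ℚ)) _)
  have hev : Rat.HeightOneSpectrum.primesEquiv (R := 𝓞 ℚ)
      ((Rat.HeightOneSpectrum.primesEquiv (R := 𝓞 ℚ)).symm ⟨ℓ, hℓ⟩) = ⟨ℓ, hℓ⟩ := Equiv.apply_symm_apply _ _
  rw [hgen, WeierstrassCurve.frobeniusTraceAt_eq_frobeniusTrace, hev]
  show ((3 : ℕ) : ℤ) ∣ (ℓ : ℤ) + 1 - W.frobeniusTrace ℓ
  unfold WeierstrassCurve.frobeniusTrace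
  rw [show (ℓ : ℤ) + 1 - ((ℓ : ℤ) + 1 - (W.reductionPointCount ℓ : ℤ)) = (W.reductionPointCount ℓ : ℤ) by ring]
  exact_mod_cast hdvd

end Summit.BirchSwinnertonDyer.Rank1Residual.X2.RouteGThreeTorsion

end
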